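import Summits.PneNP.PneNP.Theses.Circuit
import Literature.Computability.Complexity.ThresholdGadgets
import Literature.Computability.Complexity.CountingHierarchyPH
import Literature.Computability.Complexity.NondeterministicProofs
import Literature.Barriers.PneNP.LocalityParityScope
import Literature.Computability.MetaComplexity.SmolenskyModq

/-!
# `CircuitNpTc0` (stmt-PneNP-0039, route `Circuit`): the crux HOLDS below the majority gate, and
# symmetric witnesses are excluded

Negative knowledge for the crux
`Summit.PneNP.PneNP.Theses.Circuit.CircuitNpTc0 = ¬ (NP ⊆ TC0)` (refuter, cdisprove cycle 1; the crux is
the open problem `NP ⊄ non-uniform TC⁰` and is NOT refuted — this file asserts no Theses declaration):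

* Basis tightness ("tightness from below"): weakening `tcBasis` to `acBasis` or to `accBasis p`
  (`p` prime) turns the crux into a theorem — `NP_not_subset_AC0`, `NP_not_subset_AC0Mod_prime` —
  by the landed `Literature.Barriers.PneNP.PARITY_not_mem_AC0` (Håstad) and
  `Smolensky1987_modq_not_mem_AC0Mod_holds` (Razborov–Smolensky), once `PARITY ∈ P ⊆ NP` and
  `MOD_q ∈ P ⊆ NP` are recorded (`countMod_mem_P`: a `q`-state finite-state transducer, `mem_P_of_fst`).
* The separating languages are themselves in `TC⁰` (`PARITY_mem_TC0`, `modqZero_mem_TC0`,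
  `separators_mem_TC0_inter_NP`): indeed every SYMMETRIC language is in depth-4 `TC⁰`
  (`mem_TC0_of_isSymmetric`, size `(n+1)(8n+15)+1`, one exact-count layer of majority gates).
* Refuted strengthenings: no symmetric language witnesses the crux (`not_exists_symmetric_witness`);
  "no `NP` language is in `TC⁰`" is false (`not_NP_subset_compl_TC0`).

Work file with the full census: `Summits/PneNP/PneNP/Cruxes/CircuitNpTc0/Disproof.lean`.
-/

-- `Summit.<Summit>.<Problem>`: for the single-conjunct summit `PneNP` the duplicate `PneNP.PneNP` is mandated.
set_option linter.dupNamespace false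

namespace Summit.PneNP.PneNP.Theorems.CircuitNpTc0.Negative

open Literature.Computability.Complexity
open Literature.Computability.MetaComplexity

/-! ### Counting modulo `m` is in `P` (a finite-state transducer) -/

/-- The `m`-state counter: state = number of ones read so far modulo `m`; the verdict `acc` is read
off the final residue. [folklore] -/
def countModT (m : ℕ) (acc : ℕ → Bool) : FST (ZMod m) Bool Bool where
  init := 0
  step s a := (if a then s + 1 else s, [])
  front s := [acc s.val]
  keep _ := false

/-- The run of `countModT` adds the number of ones read. [folklore] -/
theorem countModT_run_fst (m : ℕ) (acc : ℕ → Bool) (s : ZMod m) (l : List Bool) :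
    ((countModT m acc).run s l).1 = s + (l.count true : ℕ) := by
  induction l generalizing s with
  | nil => simp
  | cons a l ih =>
    rw [FST.run_cons, ih, List.count_cons]
    cases a <;> simp [countModT]
    ring

/-- The verdict of `countModT`. [folklore] -/
theorem countModT_eval (m : ℕ) [NeZero m] (acc : ℕ → Bool) (l : List Bool) :
    (countModT m acc).eval l = [acc (l.count true % m)] := by
  simp only [FST.eval, countModT_run_fst]
  simp [countModT]

/-- **`{x | acc (#₁(x) mod m)} ∈ P`** for every residue test `acc` (regular, via `mem_P_of_fst`).
[folklore] -/
theorem countMod_mem_P (m : ℕ) [NeZero m] (acc : ℕ → Bool) :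
    {x : List Bool | acc (x.count true % m) = true} ∈ Classes.P :=
  mem_P_of_fst (countModT m acc) _ fun w =>
    ⟨fun hw => by rw [countModT_eval, show acc (w.count true % m) = true from hw],
     fun hw => by rw [countModT_eval, Bool.eq_false_iff.2 hw]⟩

/-- `MOD_q = {x | q ∣ #₁(x)} ∈ P`. [folklore] -/
theorem modqZero_mem_P (q : ℕ) [NeZero q] : {x : List Bool | x.count true % q = 0} ∈ Classes.P := by
  have h := countMod_mem_P q (fun r => decide (r = 0))
  simp only [decide_eq_true_eq] at h
  exact h

/-- The tree's `PARITY` as a counting language. [folklore] -/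
theorem PARITY_eq_countMod : PARITY = {x : List Bool | x.count true % 2 ≠ 0} := by
  refine Set.ext fun x => ?_
  show parityFn x.length x.get = true ↔ x.count true % 2 ≠ 0
  rw [parityFn, decide_eq_true_eq, Smolensky.count_true_eq_numOnes_get]
  omega

/-- **`PARITY ∈ P`.** [folklore] -/
theorem PARITY_mem_P : PARITY ∈ Classes.P := by
  have h := countMod_mem_P 2 (fun r => !decide (r = 0))
  rw [PARITY_eq_countMod]
  simp only [Bool.not_eq_true', decide_eq_false_iff_not] at h
  exact h

/-- `PARITY ∈ NP` (non-degeneracy witness for the left-hand side of the crux). [folklore] -/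
theorem PARITY_mem_NP : PARITY ∈ Nondeterministic.NP := P_subset_NP_holds PARITY_mem_P

/-- `MOD_q ∈ NP`. [folklore] -/
theorem modqZero_mem_NP (q : ℕ) [NeZero q] :
    {x : List Bool | x.count true % q = 0} ∈ Nondeterministic.NP :=
  P_subset_NP_holds (modqZero_mem_P q)

/-! ### Below `MAJ` the crux is a theorem -/

/-- **`NP ⊄ AC⁰`** — the crux over the basis `acBasis` holds (via the landed
`Literature.Barriers.PneNP.PARITY_not_mem_AC0`). [folklore] -/
theorem NP_not_subset_AC0 : ¬ (Nondeterministic.NP ⊆ AC0) := fun h =>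
  Literature.Barriers.PneNP.PARITY_not_mem_AC0 (h PARITY_mem_NP)

/-- **`NP ⊄ AC⁰[p]` for every prime `p`** — the crux over `accBasis p` holds (via the landed
`Smolensky1987_modq_not_mem_AC0Mod_holds`; witness `MOD₃` for `p = 2`, `PARITY` for odd `p`).
[folklore] -/
theorem NP_not_subset_AC0Mod_prime {p : ℕ} (hp : p.Prime) : ¬ (Nondeterministic.NP ⊆ AC0Mod p) := by
  intro h
  by_cases hp2 : p = 2
  · subst hp2
    exact Smolensky1987_modq_not_mem_AC0Mod_holds 2 3 Nat.prime_two Nat.prime_three (by decide)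
      (h (modqZero_mem_NP 3))
  · exact Smolensky1987_modq_not_mem_AC0Mod_holds.parity_not_mem hp hp2 (h PARITY_mem_NP)

/-! ### Symmetric languages are in `TC⁰` (depth 4) -/

/-- A language is symmetric if membership depends only on the length and the number of ones.
[folklore] -/
def IsSymmetric (L : Language Bool) : Prop :=
  ∃ A : ℕ → ℕ → Bool, ∀ x, x ∈ L ↔ A x.length (x.count true) = true

/-- The invariance form implies the table form. [folklore] -/
theorem isSymmetric_of_forall {L : Language Bool}
    (h : ∀ x y : List Bool, x.length = y.length → x.count true = y.count true → (x ∈ L ↔ y ∈ L)) :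
    IsSymmetric L := by
  classical
  refine ⟨fun n k => decide (∃ x ∈ L, x.length = n ∧ x.count true = k), fun x => ?_⟩
  rw [decide_eq_true_eq]
  exact ⟨fun hx => ⟨x, hx, rfl, rfl⟩, fun ⟨y, hy, hl, hc⟩ => (h x y hl.symm hc.symm).2 hy⟩

/-- The slice of a symmetric language is a function of `numOnes`. [folklore] -/
theorem sliceFn_of_isSymmetric {L : Language Bool} {A : ℕ → ℕ → Bool}
    (hA : ∀ x, x ∈ L ↔ A x.length (x.count true) = true) (n : ℕ) (v : Fin n → Bool) :
    L.sliceFn n v = A n (GateFn.numOnes v) := by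
  show L.boolIndicator (List.ofFn v) = _
  have key : List.ofFn v ∈ L ↔ A n (GateFn.numOnes v) = true := by
    rw [hA, List.length_ofFn, Smolensky.count_true_ofFn]
  by_cases h : List.ofFn v ∈ L
  · rw [(Set.mem_iff_boolIndicator _ _).1 h, key.1 h]
  · rw [(Set.notMem_iff_boolIndicator _ _).1 h]
    exact (Bool.eq_false_iff.2 fun h' => h (key.2 h')).symm

/-- A symmetric slice is realised over `tcBasis` at depth 4 with `(n+1)(8n+15)+1` gates
(`acRealOver_wsum_pred` with unit weights; Vollmer 1999, Thm. 1.37). [folklore] -/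
theorem acRealOver_symmetric_slice (A : ℕ → Bool) (n : ℕ) :
    ACRealOver tcBasis (fun v : Fin n → Bool => A (GateFn.numOnes v)) 4
      ((n + 1) * (4 * (n + (n + 1)) + 11) + 1) := by
  have hR : (∑ _a : Fin n, (1 : ℕ)) < n + 1 := by simp
  have h := acRealOver_wsum_pred (fun _ : Fin n => (1 : ℕ)) hR (fun k => A k = true)
  have hs : (∑ _a : Fin n, (1 : ℕ)) = n := by simp
  rw [hs] at h
  refine h.congr fun y => ?_
  rw [wsum_one]
  show decide (A (GateFn.numOnes y) = true) = A (GateFn.numOnes y)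
  cases A (GateFn.numOnes y) <;> rfl

/-- **Symmetric languages are in `TC⁰`** (depth 4, size `(n+1)(8n+15)+1`), whatever their uniform
complexity. [folklore] -/
theorem mem_TC0_of_isSymmetric {L : Language Bool} (hL : IsSymmetric L) : L ∈ TC0 := by
  obtain ⟨A, hA⟩ := hL
  refine ⟨4, (Polynomial.X + 1) * (4 * (Polynomial.X + (Polynomial.X + 1)) + 11) + 1, ?_⟩
  have key : ∀ n, ∃ C : Circuit (Fin n), C.IsOver tcBasis ∧ C.acDepth ≤ 4 ∧
      C.size ≤ (n + 1) * (4 * (n + (n + 1)) + 11) + 1 ∧ C.Computes (L.sliceFn n) := fun n =>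
    ((acRealOver_symmetric_slice (A n) n).congr fun v =>
      (sliceFn_of_isSymmetric hA n v).symm).toCircuit
  choose C hC using key
  refine ⟨C, fun n => ⟨(hC n).1, (hC n).2.1, (hC n).2.2.1.trans (le_of_eq ?_)⟩, fun x => ?_⟩
  · simp [Polynomial.eval_add, Polynomial.eval_mul]
  · rw [(hC x.length).2.2.2 x.get]
    show L.boolIndicator (List.ofFn x.get) = L.boolIndicator x
    rw [List.ofFn_get]

/-- Counting languages are symmetric. [folklore] -/
theorem countMod_isSymmetric (m : ℕ) (acc : ℕ → Bool) :
    IsSymmetric {x : List Bool | acc (x.count true % m) = true} :=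
  ⟨fun _ k => acc (k % m), fun _ => Iff.rfl⟩

/-- `PARITY` is symmetric. [folklore] -/
theorem PARITY_isSymmetric : IsSymmetric PARITY := by
  rw [PARITY_eq_countMod]
  refine ⟨fun _ k => !decide (k % 2 = 0), fun x => ?_⟩
  show x.count true % 2 ≠ 0 ↔ _
  simp

/-- **`PARITY ∈ TC⁰`** — the `AC⁰` separator is absorbed by one layer of majority gates. [folklore] -/
theorem PARITY_mem_TC0 : PARITY ∈ TC0 := mem_TC0_of_isSymmetric PARITY_isSymmetric

/-- **`MOD_q ∈ TC⁰`** — the `AC⁰[p]` separators are absorbed as well. [folklore] -/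
theorem modqZero_mem_TC0 (q : ℕ) : {x : List Bool | x.count true % q = 0} ∈ TC0 := by
  have h := mem_TC0_of_isSymmetric (countMod_isSymmetric q (fun r => decide (r = 0)))
  simp only [decide_eq_true_eq] at h
  exact h

/-- **Refuted strengthening of `CircuitNpTc0` (symmetric witness)**: no SYMMETRIC language (in `NP`
or not) witnesses the crux. [folklore] -/
theorem not_exists_symmetric_witness :
    ¬ ∃ L ∈ Nondeterministic.NP, IsSymmetric L ∧ L ∉ TC0 := by
  rintro ⟨L, -, hs, hL⟩
  exact hL (mem_TC0_of_isSymmetric hs)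

/-- **Refuted strengthening (uniform form)**: "no `NP` language is in `TC⁰`" is false — `NP ∩ TC⁰`
is rich. [folklore] -/
theorem not_NP_subset_compl_TC0 : ¬ (Nondeterministic.NP ⊆ TC0ᶜ) := fun h =>
  h PARITY_mem_NP PARITY_mem_TC0

/-- The separators used below `MAJ` sit in `TC⁰ ∩ NP`: the Razborov–Smolensky / switching-lemma
witnesses certify the crux for every basis strictly below `MAJ` and are useless at `MAJ`. [folklore] -/
theorem separators_mem_TC0_inter_NP :
    PARITY ∈ TC0 ∩ Nondeterministic.NP ∧
      ∀ q : ℕ, [NeZero q] → {x : List Bool | x.count true % q = 0} ∈ TC0 ∩ Nondeterministic.NP :=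
  ⟨⟨PARITY_mem_TC0, PARITY_mem_NP⟩, fun q _ => ⟨modqZero_mem_TC0 q, modqZero_mem_NP q⟩⟩

end Summit.PneNP.PneNP.Theorems.CircuitNpTc0.Negative
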